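import Summits.CriticalPhenomena.CardyFormulaZ2.Theorems.CardyMagicRigidityNestingRigidityNeckZ2ErrorCover
import Summits.CriticalPhenomena.CardyFormulaZ2.Theorems.CardyMagicRigidityNestingRigidityNeckZ2CoveringAChain
import HarnessLib

/-!
# Crux `NestingRigidity`, line `pinch-resampling` (v4), stub S12: the `𝔄`-error covered by the NECKLACE node event, and S12 from its bound

Crux `Summit.CriticalPhenomena.CardyFormulaZ2.Theses.CardyMagicRigidity.NestingRigidity`
(stmt-CriticalPhenomena-4835), line `pinch-resampling` v4, stub S12 `stub_neckHookupCoarseZ2 : NeckHookupCoarseZ2`.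
Correction of the 𝔄-half of `…NeckZ2ErrorCover` (wave 5, worker W1, target `ZNodeAbsBoundA`).

**Finding.**  `ZNodeAbsBoundA` (smallness of `ZNodeEventA`, which keeps of the minimal re-connecting family only the
four-arm node property over `F`-FREE SHELLS) is not derivable from the tree's arm bounds — all of the form
`≤ c · ratio^{-exponent}` with non-explicit `c`, vacuous at bounded ratio — by any union bound over skeletons: a
family `{z} ∪ C` with `C` a spanning background none of whose sub-clusters has an `F`-free shell of modulus `≥ M`
(uncertifiable) and `z` one isolated locale has the single certified annulus `(ℓ, Mℓ)` at `z`, and the union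
bound over `z` alone is `(8s/ℓ) · c M^{-(1+ε)} ↛ 0`; the truth of `ZNodeAbsBoundA` itself hinges on bounded-ratio
constants.  The cure is to keep the INTRINSIC structure of the minimal family (`…NeckZ2CoveringAChain`,
`zCovering_A_chain`): a rank order, inner/outer endpoints, and the NECKLACE of pairwise distinct open clusters
`Y₀ ∋ b`, `Y_e ∋ outP e`, `Y_{max} ∋ b'` of `Λ_{2s}(x)`, consecutive ones sharing an `ℓ`-cell, every locale in a
blob of sup-diameter `≥ lam`.

* §1 `ZNodeEventChainA ℓ lam s x o` — the necklace node event (the chain clauses of `zCovering_A_chain` with the two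
  crossings `b, b'` quantified, plus the node property of `ZNodeEventA`); `ZNodeEventChainA ⊆ ZNodeEventA`.
* §2 `symmDiff_zHookR_zHookStar_subset_chain`: on lattice configurations
  `ZHookR Δ ZHookStar ⊆ ZNodeEventChainA ∪ ZNodeEventB`.
* §3 `ZNodeAbsBoundChainA : Prop` (the corrected W1 target, NOT asserted; weaker than `ZNodeAbsBoundA`) and
  `neckHookupCoarseZ2_of_chainInputs : ZFourStrandsPositive → ZNodeAbsBoundChainA → ZNodeAbsBoundB →
  NeckHookupCoarseZ2` (registered anchor).

**Status of `ZNodeAbsBoundChainA` (OPEN) and road map.**  Certified inputs now in the tree: (N) interval/sub-family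
node events — two distinct necklace clusters straddling the boundary of a sub-family both cross every annulus between
the sub-family and the rest (`exists_zAnn_crossing_of_pathIn`, `mem_fourArmTwoClustersAt_of_crossings`), products
over disjoint annuli `real_biInter_fourArmTwoClustersAt_le_prod_rpow` (`…NeckZ2NodeProduct`); (B) arms of pairwise
DISTINCT clusters cost the product with no disjointness of annuli, `real_distinctClusters_arms_le_prod`
(`…NeckZ2NodeBK`: at resolution `ℓ` every certified big cluster pays `C (2ℓ/lam)^α`, and the map junction ↦ big
cluster is `≤ 2`-to-`1`); (R) both at once when the arm clusters are not the nodes' crossing clusters,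
`real_fourArm_and_distinctArms_le` (`…NeckZ2NodeReimer`).  What (B) buys: dense clumps and bounded-ratio
("non-lacunary") structure BELOW scale `lam` are no longer free — `m` junctions in a ball of radius `Δ ≪ lam` cost
`(C (2Δ/lam)^α)^{m/2}` — which removes the obstruction recorded above for `ZNodeEventA`.  What is NOT done: the
bookkeeping of the union bound over necklace skeletons (cells in rank order; hop entropy `log(2δ_i/ℓ)` per junction,
to be paid by (N) along the hierarchy of isolated sub-families for lacunary structure and by (B) for the rest), and
in particular the assignment of WITNESSES: a cluster serving as crossing cluster of a node cannot also lend an arm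
through that node's annulus (use (R) with the clusters INTERNAL to a sub-family — both touched cells inside — which
are never crossing clusters of any node, or arm segments spatially outside the node annuli).  The window
`s³ℓ ≤ lam⁴` is not expected to be used.
-/

noncomputable section

namespace Summit.CriticalPhenomena.CardyFormulaZ2.Cruxes.NestingRigidity.PinchResampling

open MeasureTheory Set Literature.Probability.Percolation Literature.Probability.LatticeModels
open ZPinchLocality
open NeckCoarseZ2
open scoped symmDiff

/-! ## §1 The necklace node event -/

/-- **Necklace node event for `𝔄`**: a nonempty finite family `F` of virtual edges with the node property of
`ZNodeEventA`, two open crossings `b, b'` of the collar, a rank `rk` injective on `F` and inner/outer endpoints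
`inP e, outP e` of every edge, such that `b ⟶ inP e_min`, `outP e ⟶ inP e'` for rank-consecutive `e, e'`,
`outP e_max ⟶ b'` by open paths of `Λ_{2s}(x)`, while `b ≁ outP e` and `outP e ≁ outP e'` (`rk e < rk e'`): the
open clusters met along the ranks are pairwise distinct. -/
def ZNodeEventChainA (ℓ lam s : ℕ) (x o : Site 2) : Set (BondConfig (Site 2)) :=
  {ω | ∃ (F : Finset (Site 2 × Site 2)) (b b' : Site 2) (rk : Site 2 × Site 2 → ℕ)
      (inP outP : Site 2 × Site 2 → Site 2),
    ↑F ⊆ zVEdges ℓ lam s x o ω ∧ F.Nonempty ∧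
    IsCrossing (zdGraph 2) (openGraph ω) (zBall x s) (zBall x (2 * s)) b ∧
    IsCrossing (zdGraph 2) (openGraph ω) (zBall x s) (zBall x (2 * s)) b' ∧
    (∀ 𝒩 ⊆ F, 𝒩.Nonempty → ∀ (w : Site 2) (Δ r R Γ : ℕ),
      w ∈ innerLayer (zdGraph 2) (zBall x s) (zBall x (2 * s)) →
      (∀ e ∈ 𝒩, zNorm (e.2 - w) ≤ Δ) → (∀ e ∈ F, e ∉ 𝒩 → (Γ : ℤ) ≤ zNorm (e.2 - w)) →
      Δ + ℓ ≤ r → r ≤ R → R + ℓ ≤ Γ → R + 1 ≤ s → ω ∈ fourArmTwoClustersAt w r R) ∧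
    Set.InjOn rk ↑F ∧ (∀ e ∈ F, (inP e, outP e) = e ∨ (outP e, inP e) = e) ∧
    (∀ e ∈ F, (∀ e' ∈ F, rk e ≤ rk e') → PathIn (openGraph ω) (zBall x (2 * s)) b (inP e)) ∧
    (∀ e ∈ F, (∀ e' ∈ F, rk e' ≤ rk e) → PathIn (openGraph ω) (zBall x (2 * s)) (outP e) b') ∧
    (∀ e ∈ F, ∀ e' ∈ F, rk e < rk e' → (∀ e'' ∈ F, rk e'' ≤ rk e ∨ rk e' ≤ rk e'') →
      PathIn (openGraph ω) (zBall x (2 * s)) (outP e) (inP e')) ∧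
    (∀ e ∈ F, ¬ PathIn (openGraph ω) (zBall x (2 * s)) b (outP e)) ∧
    (∀ e ∈ F, ∀ e' ∈ F, rk e < rk e' → ¬ PathIn (openGraph ω) (zBall x (2 * s)) (outP e) (outP e'))}

/-- The necklace node event implies the node event of `…NeckZ2ErrorCover`. -/
theorem zNodeEventChainA_subset (ℓ lam s : ℕ) (x o : Site 2) : ZNodeEventChainA ℓ lam s x o ⊆ ZNodeEventA ℓ lam s x o :=
  fun _ ⟨F, _, _, _, _, _, hF, hne, _, _, hnode, _⟩ ↦ ⟨F, hF, hne, hnode⟩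

/-! ## §2 The error decomposition, necklace form -/

/-- **The error decomposition of the surrogate, necklace form**: on lattice configurations, for `1 ≤ ℓ` and
`lam + 1 ≤ s`, `ZHookR Δ ZHookStar ⊆ ZNodeEventChainA ∪ ZNodeEventB`. -/
theorem symmDiff_zHookR_zHookStar_subset_chain {ℓ lam s : ℕ} (x o : Site 2) (hℓ : 1 ≤ ℓ) (hls : lam + 1 ≤ s) :
    (ZHookR x s ∆ ZHookStar ℓ lam s x o) ∩ {ω | ω ⊆ (zdGraph 2).edgeSet} ⊆
      ZNodeEventChainA ℓ lam s x o ∪ ZNodeEventB lam s x := by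
  rintro ω ⟨hΔ, hω⟩
  have hHG := NeckCoarseZ2.openGraph_adj_lattice hω
  rcases mem_symmDiff.1 hΔ with ⟨hH, hnS⟩ | ⟨hS, hnH⟩
  · -- 𝔅, exactly as in `symmDiff_zHookR_zHookStar_subset`
    right
    have hnB : ω ∉ ZHookBig lam s x := fun hB ↦ hnS
      (fuzzyHook_of_zHookBig (ℓ := ℓ) (o := o) hHG (Z := zIntGraph x s ω) (fun _ _ h1 h2 h3 ↦ ⟨h1, h2, h3⟩) hB)
    obtain ⟨F, hF, hne, hside, hnode⟩ := zCovering_B hHG hls hH hnB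
    exact ⟨F, hF, hne, hside, hnode⟩
  · -- 𝔄: a fuzzy hook-up which is not honest, via the chain form of the covering lemma
    left
    obtain ⟨b, b', hb, hb', hnR, hchain⟩ :=
      exists_stepChain_of_fuzzyHook hls (NeckCoarseZ2.zIntGraph_le_openGraph x s ω) hS hnH
    obtain ⟨F, hF, hne, hnode, rk, inP, outP, hinj, hor, hmin, hmax, hcov, hb0, hlt⟩ :=
      zCovering_A_chain ℓ lam s x o ω hHG hℓ b b' hb hb' hnR hchain
    exact ⟨F, b, b', rk, inP, outP, hF, hne, hb, hb', hnode, hinj, hor, hmin, hmax, hcov, hb0, hlt⟩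

/-! ## §3 S12 from the necklace node bound -/

/-- **Relative necklace bound for `𝔄`** (a statement, NOT asserted): in the window, `ZNodeEventChainA` has
probability at most `b` times that of the selection event. -/
def ZNodeBoundChainA : Prop :=
  ∀ b : ℝ, 0 < b → ∃ L : ℕ, ∀ (x o : Site 2) (ℓ lam s : ℕ), 1 ≤ ℓ → s ^ 3 * ℓ ≤ lam ^ 4 → L * lam ≤ s →
    (bondPercolation (zdGraph 2) half).real (ZFourStrands x s ∩ ZNodeEventChainA ℓ lam s x o) ≤
      b * (bondPercolation (zdGraph 2) half).real (ZFourStrands x s)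

/-- **Absolute necklace bound for `𝔄`** (the corrected target of worker W1; a statement, NOT asserted): in the window
the necklace node event has probability `≤ b`.  Weaker than `ZNodeAbsBoundA` (`zNodeAbsBoundChainA_of_abs`); see the
module docstring for the road map of its proof from `…NeckZ2NodeProduct`, `…NeckZ2NodeBK`, `…NeckZ2NodeReimer`. -/
def ZNodeAbsBoundChainA : Prop :=
  ∀ b : ℝ, 0 < b → ∃ L : ℕ, ∀ (x o : Site 2) (ℓ lam s : ℕ), 1 ≤ ℓ → s ^ 3 * ℓ ≤ lam ^ 4 → L * lam ≤ s →
    (bondPercolation (zdGraph 2) half).real (ZNodeEventChainA ℓ lam s x o) ≤ b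

/-- The old absolute bound implies the corrected one. -/
theorem zNodeAbsBoundChainA_of_abs (hA : ZNodeAbsBoundA) : ZNodeAbsBoundChainA := by
  intro b hb
  obtain ⟨L, hL⟩ := hA b hb
  exact ⟨L, fun x o ℓ lam s hℓ hw hLs ↦ le_trans
    (measureReal_mono (zNodeEventChainA_subset ℓ lam s x o) (measure_ne_top _ _)) (hL x o ℓ lam s hℓ hw hLs)⟩

/-- **`ZHookStarBound` from the necklace bound and the `𝔅`-bound** (adapted from `zHookStarBound_of_nodeBounds`). -/
theorem zHookStarBound_of_chainNodeBounds : ZNodeBoundChainA → ZNodeBoundB → ZHookStarBound := by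
  intro hA hB b hb
  obtain ⟨L₁, hL₁⟩ := hA (b / 2) (by positivity)
  obtain ⟨L₂, hL₂⟩ := hB (b / 2) (by positivity)
  refine ⟨max (max L₁ L₂) 2, fun x o ℓ lam s hℓ hw hLs ↦ ?_⟩
  set μ := bondPercolation (zdGraph 2) half with hμ
  have hL₁s : L₁ * lam ≤ s := le_trans (Nat.mul_le_mul_right lam ((le_max_left _ _).trans (le_max_left _ _))) hLs
  have hL₂s : L₂ * lam ≤ s := le_trans (Nat.mul_le_mul_right lam ((le_max_right _ _).trans (le_max_left _ _))) hLs
  have h2s : 2 * lam ≤ s := le_trans (Nat.mul_le_mul_right lam (le_max_right _ _)) hLs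
  rcases Nat.eq_zero_or_pos s with rfl | hs
  · simp [NeckCoarseZ2.zFourStrands_zero]
  have hls : lam + 1 ≤ s := by
    rcases Nat.eq_zero_or_pos lam with rfl | hlam
    · omega
    · omega
  have hae : ∀ᵐ ω ∂μ, ω ⊆ (zdGraph 2).edgeSet := ae_subset_edgeSet (zdGraph 2) half
  have hcover : ZFourStrands x s ∩ (ZHookR x s ∆ ZHookStar ℓ lam s x o) ∩ {ω | ω ⊆ (zdGraph 2).edgeSet} ⊆
      ZFourStrands x s ∩ ZNodeEventChainA ℓ lam s x o ∪ ZFourStrands x s ∩ ZNodeEventB lam s x := by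
    rintro ω ⟨⟨hSel, hΔ⟩, hω⟩
    rcases symmDiff_zHookR_zHookStar_subset_chain x o hℓ hls ⟨hΔ, hω⟩ with h | h
    · exact Or.inl ⟨hSel, h⟩
    · exact Or.inr ⟨hSel, h⟩
  have heq : μ.real (ZFourStrands x s ∩ (ZHookR x s ∆ ZHookStar ℓ lam s x o)) =
      μ.real (ZFourStrands x s ∩ (ZHookR x s ∆ ZHookStar ℓ lam s x o) ∩ {ω | ω ⊆ (zdGraph 2).edgeSet}) := by
    refine measureReal_congr (Filter.eventuallyEq_set.2 (hae.mono fun ω hω ↦ ?_))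
    simp only [mem_inter_iff, mem_setOf_eq, hω, and_true]
  calc μ.real (ZFourStrands x s ∩ (ZHookR x s ∆ ZHookStar ℓ lam s x o))
      = μ.real (ZFourStrands x s ∩ (ZHookR x s ∆ ZHookStar ℓ lam s x o) ∩ {ω | ω ⊆ (zdGraph 2).edgeSet}) := heq
    _ ≤ μ.real (ZFourStrands x s ∩ ZNodeEventChainA ℓ lam s x o ∪ ZFourStrands x s ∩ ZNodeEventB lam s x) :=
        measureReal_mono hcover (measure_ne_top _ _)
    _ ≤ μ.real (ZFourStrands x s ∩ ZNodeEventChainA ℓ lam s x o) + μ.real (ZFourStrands x s ∩ ZNodeEventB lam s x) :=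
        measureReal_union_le _ _
    _ ≤ b / 2 * μ.real (ZFourStrands x s) + b / 2 * μ.real (ZFourStrands x s) :=
        add_le_add (hL₁ x o ℓ lam s hℓ hw hL₁s) (hL₂ x lam s hL₂s)
    _ = b * μ.real (ZFourStrands x s) := by ring

/-- **Relative from absolute, necklace form** (adapted from `zNodeBoundA_of_abs`). -/
theorem zNodeBoundChainA_of_abs (hpos : ZFourStrandsPositive) (hA : ZNodeAbsBoundChainA) : ZNodeBoundChainA := by
  obtain ⟨s₀, c₀, hc₀, hpos⟩ := hpos
  intro b hb
  obtain ⟨L₁, hL₁⟩ := hA (b * c₀) (by positivity)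
  refine ⟨max L₁ s₀, fun x o ℓ lam s hℓ hw hLs ↦ ?_⟩
  set μ := bondPercolation (zdGraph 2) half with hμ
  have hL₁s : L₁ * lam ≤ s := le_trans (Nat.mul_le_mul_right lam (le_max_left _ _)) hLs
  rcases Nat.eq_zero_or_pos lam with rfl | hlam
  · have hs : s = 0 := by
      by_contra hs
      have : 1 ≤ s ^ 3 * ℓ := Nat.one_le_iff_ne_zero.2 (by positivity)
      simp at hw
      omega
    subst hs
    simp [NeckCoarseZ2.zFourStrands_zero]
  · have hs₀ : s₀ ≤ s := by nlinarith [le_max_right L₁ s₀]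
    calc μ.real (ZFourStrands x s ∩ ZNodeEventChainA ℓ lam s x o) ≤ μ.real (ZNodeEventChainA ℓ lam s x o) :=
          measureReal_mono inter_subset_right (measure_ne_top _ _)
      _ ≤ b * c₀ := hL₁ x o ℓ lam s hℓ hw hL₁s
      _ ≤ b * μ.real (ZFourStrands x s) := mul_le_mul_of_nonneg_left (hpos x s hs₀) hb.le

/-- **S12 from RSW positivity of the selection event, the absolute NECKLACE bound for `𝔄` and the absolute bound for
`𝔅` (registered helper, anchor of this module on the crux item)** — the corrected remaining inputs of stub S12. -/
theorem neckHookupCoarseZ2_of_chainInputs : ZFourStrandsPositive → ZNodeAbsBoundChainA → ZNodeAbsBoundB → NeckHookupCoarseZ2 :=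
  fun hpos hA hB ↦ neckHookupCoarseZ2_of_hookStarBound
    (zHookStarBound_of_chainNodeBounds (zNodeBoundChainA_of_abs hpos hA) (zNodeBoundB_of_abs hpos hB))

end Summit.CriticalPhenomena.CardyFormulaZ2.Cruxes.NestingRigidity.PinchResampling

end
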